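import Summits.BirchSwinnertonDyer.BirchSwinnertonDyer.Theorems.SignedBaseChangeAnticyclotomicEisensteinDivisibilityAdmdefChebSplit
import HarnessLib

/-!
# Line `admdef`, cell β: ČEBOTAREV WITH THE SIGN FOR AN INDEPENDENT FAMILY OF CLASSES at ONE Bertolini–Darmon admissible prime,
# `p ≥ 5`, from the admissible target (Howard's two-class Čebotarev; crux `AnticyclotomicEisensteinDivisibility`,
# stmt-BirchSwinnertonDyer-20727; LEAD seat bsd-line-sbc-p1 gen 27, `--supports stmt-BirchSwinnertonDyer-20727`; rigidity road item (M3)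
# of `Lines/admdef-lead-g25.md` §4; companion of `…AdmdefChebSplit.lean`)

WHY THIS FILE.  Howard's rigidity induction for a bipartite Euler system ([Howard2006] Thm. 3.2.3, [BurungaleCastellaKim2021] Prop. 7.4)
and W. Zhang's triangulation need, at each step, ONE admissible prime `q` at which SEVERAL given classes (the current class `κ(n)` and a
generator of the relevant Selmer eigenspace) are simultaneously visible.  The tree has the one-class theorem (`…AdmdefChebSplit`,
a port of the AKR cell's `AdditiveKoly.Cheb.exists_admissible_loc_ne_zero`).  THIS FILE proves the FAMILY version with the same proof:
Gross's Prop. 9.3 in the tree (`exists_h1Eval_eq`) already prescribes the values of an INDEPENDENT family of classes at one element of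
`Γ_{K(E[p])}`, so the single Čebotarev element of the one-class proof can be chosen to serve every member of the family at once.

* `exists_admissible_forall_loc_ne_zero_of_target` — `K` imaginary quadratic, `ρ̄_{E,p}` onto, `p ≥ 5`, `c ≠ 1`, `ν = ±1`, the admissible
  target for `(c, ν)` (as in `…AdmdefChebSplit`), a finite family `xs : Fin r → H¹(K, E[p])` of `ν`-eigenclasses of `c_*` which is
  LINEARLY INDEPENDENT over `𝔽_p` (`∑ aᵢ xᵢ = 0 ⟹ p ∣ aᵢ`), `B₀ ⊂ ℕ` finite ⟹ ∃ Bertolini–Darmon `1`-admissible `q ∉ B₀` (sign rule `ε_q = ν`)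
  and a place `v ∋ q` of `K` with `loc_v xᵢ ≠ 0` in `H¹(K_v, E[p])` FOR EVERY `i`.  (All the classes must have the SAME sign: at an
  admissible prime with `ε_q = ν` only `ν`-eigenclasses can be visible.)

PROOF = the one-class proof verbatim with the class-dependent steps run over the family: Step B prescribes `ξᵢ(ρ) = yᵢ` for all `i` at one
`ρ ∈ Γ_{K(E[p])}` (`exists_h1Eval_eq` with the independence hypothesis), Step C takes the union of the ramification sets, Step D the joint
kernel `evalKer xs`, Steps E–F (the prime `ℓ`, inert, Frobenius `τ' = conj(g) g`) are class-free, Step G's sign computation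
`(e ξᵢ(τ'))₀ = 1` and the local criterion (Gross Prop. 9.6) are run for each `i`.

HONEST FRAMING: theorems only (no definition, no named fact, no `sorry`); nothing about Heegner points, the anchors or the crux is asserted;
OFF the v23 composition path (rigidity road). BSD is not proved by this file.

References: [cite: Howard2006, Thm. 3.2.3, §3.3] [cite: BertoliniDarmon2005, Thm. 3.2] [cite: WZhang2014, Lemma 7.3] [cite: GrossLMS1991, Prop. 9.3, 9.6]
[cite: BurungaleCastellaKim2021, arXiv:1908.09512 Lem. 7.3, Prop. 7.4].
-/

-- D-0017: single-problem summit, the namespace repeats the problem name by design.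
set_option linter.dupNamespace false
set_option autoImplicit false

noncomputable section

open scoped Classical Pointwise
open Polynomial

namespace Summit.BirchSwinnertonDyer.BirchSwinnertonDyer.Theorems.SignedBaseChangeAcDivAdmdefChebSplitFamily

open WeierstrassCurve Field Function NumberField IsDedekindDomain Rat.HeightOneSpectrum
open Literature.NumberTheory.EllipticCurves Literature.NumberTheory.GaloisRepresentations Module
open Summit.BirchSwinnertonDyer.BirchSwinnertonDyer.Theorems
open Summit.BirchSwinnertonDyer.BirchSwinnertonDyer.Theorems.AdditiveKoly.Cheb
open Summit.BirchSwinnertonDyer.Rank1Residual.X11b.Three.Koly.Method2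

section Main

variable (W : WeierstrassCurve ℚ) (K : Type) [Field K] [NumberField K] [W.IsElliptic] [W.IsGloballyMinimal]

set_option maxHeartbeats 800000 in
-- (same budget as the one-class original `…AdmdefChebSplit.exists_admissible_loc_ne_zero_of_target`, whose proof this is)
/-- **Čebotarev with the sign for an independent family of eigenclasses, at ONE admissible prime** (Howard 2006 §3.3 / Bertolini–Darmon
2005 Thm. 3.2 / W. Zhang 2014 Lemma 7.3, family form, from the admissible target).  For `E = W/ℚ` in global minimal form with `ρ̄_{E,p}` onto
(`p ≥ 5`), `K` imaginary quadratic with complex conjugation `c ≠ 1`, a sign `ν = ±1`, the ADMISSIBLE TARGET for `(c, ν)` (`htarget`, as in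
`…AdmdefChebSplit`), a family `xs : Fin r → H¹(K, E[p])` of classes with `c_* xᵢ = ν xᵢ` which is linearly independent over `𝔽_p`
(`hind`), and a finite set `B₀ ⊂ ℕ`: there is a Bertolini–Darmon `1`-admissible prime `q ∉ B₀` (with `ε_q = ν`) and a place `v ∋ q` of `K`
at which the localisation of EVERY `xᵢ` in `H¹(K_v, E[p])` is non-zero. [cite: Howard2006, §3.3, Thm. 3.2.3] [cite: BertoliniDarmon2005, Thm. 3.2]
[cite: GrossLMS1991, Prop. 9.3, 9.6] [cite: WZhang2014, Lemma 7.3] -/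
theorem exists_admissible_forall_loc_ne_zero_of_target {p : ℕ} [Fact p.Prime] (h5 : 5 ≤ p) (hK : IsImaginaryQuadratic K)
    (hsurj : W.HasSurjectiveModNGaloisRep p)
    {c : K ≃ₐ[ℚ] K} (hc1 : c ≠ 1) {ν : ℤ} (hν : ν = 1 ∨ ν = -1)
    (htarget : ∀ {c₀ : absoluteGaloisGroup ℚ}
      (ht : IsLiftOfAut c (absGaloisTransport (K := ℚ) (L := K) c₀).toRingEquiv),
      (∀ x, (absGaloisTransport (K := ℚ) (L := K) c₀).toRingEquiv
        ((absGaloisTransport (K := ℚ) (L := K) c₀).toRingEquiv x) = x) →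
      ∃ (g₁ : absoluteGaloisGroup K) (e : geomTorsion (W.baseChange K) (p : ℤ) ≃+ (Fin 2 → ZMod p)),
        (∀ Q, e (ht.torsionMap W (p : ℤ) (g₁ • Q)) = ![(ν : ZMod p) * e Q 0, (ν : ZMod p) * 2 * e Q 1]) ∧
        (∀ P : geomTorsion W (p : ℤ),
          e (RatClosure.torsionEquiv (K := K) W (p : ℤ) ((c₀ * absGaloisRestrict ℚ K g₁) • P)) =
            ![(ν : ZMod p) * e (RatClosure.torsionEquiv (K := K) W (p : ℤ) P) 0,
              (ν : ZMod p) * 2 * e (RatClosure.torsionEquiv (K := K) W (p : ℤ) P) 1]))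
    {r : ℕ} {xs : Fin r → galH1Torsion (W.baseChange K) ((p : ℕ) : ℤ)}
    (hind : ∀ a : Fin r → ℤ, ∑ i, a i • xs i = 0 → ∀ i, (p : ℤ) ∣ a i)
    (hxν : ∀ i, conjAct W c ((p : ℕ) : ℤ) (xs i) = ν • xs i) (B₀ : Finset ℕ) :
    ∃ q : ℕ, q ∉ B₀ ∧ BertoliniDarmon2005.IsAdmissiblePrime (W.conductorNorm ℤ) K (fun ℓ ↦ W.frobeniusTrace ℓ) p 1 q ∧
      ∃ v : HeightOneSpectrum (𝓞 K), (q : 𝓞 K) ∈ v.asIdeal ∧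
        ∀ i, xs i ∉ (W.baseChange K).torsionLocalKer (v.adicCompletion K) ((p : ℕ) : ℤ) := by
  -- adapted from Theorems/SignedBaseChangeAnticyclotomicEisensteinDivisibilityAdmdefChebSplit.lean (itself the AKR proof
  -- Theorems/AdditiveKolyvaginRoadCheb.lean `exists_admissible_loc_ne_zero`), one class ↦ an independent family
  classical
  have hp : p.Prime := Fact.out
  have hp2 : p ≠ 2 := by omega
  haveI : Algebra.IsQuadraticExtension ℚ K := ⟨hK.1⟩
  haveI : IsTotallyComplex K := hK.2
  have hn0 : ((p : ℕ) : ℤ) ≠ 0 := by exact_mod_cast hp.ne_zero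
  have hνν : ν * ν = 1 := by rcases hν with rfl | rfl <;> norm_num
  have hννk : (ν : ZMod p) * (ν : ZMod p) = 1 := by rw [← Int.cast_mul, hνν, Int.cast_one]
  have htwo : (2 : ZMod p) ≠ 0 := by
    intro h
    have : (p : ℕ) ∣ 2 := by
      have h' : ((2 : ℕ) : ZMod p) = 0 := by exact_mod_cast h
      exact (ZMod.natCast_eq_zero_iff 2 p).mp h'
    have := Nat.le_of_dvd (by norm_num) this
    omega
  -- ### Step A: complex conjugation, the involutive lift, the admissible target
  obtain ⟨c₀, hc₀⟩ := exists_isComplexConjugation (Rat.castHom ℝ)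
  set t : AlgebraicClosure K ≃+* AlgebraicClosure K :=
    (absGaloisTransport (K := ℚ) (L := K) c₀).toRingEquiv with ht_def
  have ht : IsLiftOfAut c t :=
    RatClosure.isLiftOfAut_absGaloisTransport_of_isImaginaryQuadratic hK hc1 hc₀
  have hinv : ∀ x, t (t x) = x := fun x ↦
    RatClosure.absGaloisTransport_absGaloisTransport_of_sq_eq_one hc₀.sq_eq_one x
  -- (the one change w.r.t. the AKR proof: the admissible target is the HYPOTHESIS `htarget`)
  obtain ⟨g₁, eT, hG, hγ₁⟩ := htarget ht hinv
  set θ := RatClosure.torsionEquiv (K := K) W ((p : ℕ) : ℤ) with hθ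
  set T := ht.torsionMap W ((p : ℕ) : ℤ) with hTdef
  have hTT : ∀ Q, T (T Q) = Q := ht.torsionMap_torsionMap W hinv ((p : ℕ) : ℤ)
  have hconj : ∀ (g : absoluteGaloisGroup K) (X : geomTorsion (W.baseChange K) ((p : ℕ) : ℤ)),
      ht.conjGalCMH g • X = T (g • T X) := fun g X ↦ by
    rw [← hTT (ht.conjGalCMH g • X), hTdef, ht.torsionMap_smul W ((p : ℕ) : ℤ)]
  have hptor : ∀ X : geomTorsion (W.baseChange K) ((p : ℕ) : ℤ), (p : ℤ) • X = 0 := fun X ↦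
    Subtype.ext ((mem_geomTorsion_iff (W.baseChange K) _ _).mp X.2)
  -- the action of `T ∘ g₁` (`= D` in the frame `eT`) and of its square
  have hD1 : ∀ X : geomTorsion (W.baseChange K) ((p : ℕ) : ℤ),
      eT (T (g₁ • X)) 0 = (ν : ZMod p) * eT X 0 ∧ eT (T (g₁ • X)) 1 = (ν : ZMod p) * 2 * eT X 1 := fun X ↦ by
    rw [hG X]; exact ⟨rfl, rfl⟩
  have hD2 : ∀ X : geomTorsion (W.baseChange K) ((p : ℕ) : ℤ),
      eT (T (g₁ • T (g₁ • X))) 0 = eT X 0 ∧ eT (T (g₁ • T (g₁ • X))) 1 = 4 * eT X 1 := fun X ↦ by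
    obtain ⟨h0, h1⟩ := hD1 (T (g₁ • X))
    obtain ⟨h0', h1'⟩ := hD1 X
    rw [h0', ← mul_assoc, hννk, one_mul] at h0
    rw [h1'] at h1
    refine ⟨h0, ?_⟩
    rw [h1]
    linear_combination (4 * eT X 1) * hννk
  -- ### Step B: the module `E(K̄)[p]` (simple, scalar commutant, `-1`, `2⁻¹`) and Prop. 9.3
  have hsq := RatClosure.exists_smul_eq_of_sq (K := K) W hK.1 (n := ((p : ℕ) : ℤ)) hsurj
  obtain ⟨z, hz⟩ := KolyvaginImage.exists_smul_eq_neg eT hsq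
  have hS := KolyvaginImage.eq_bot_or_eq_top eT hsq hp2
  have hCe := KolyvaginImage.exists_eq_zsmul eT hsq hp2
  obtain ⟨u, hu⟩ := KolyvaginImage.exists_two_mul_zsmul_eq eT (p := p) hp2
  -- the cocycles of the `xs i` (as `E(K̄)[p]`-valued functions `ξ i`), the constants `κ₀ i`, the target values `y i`, and `ρ`
  set φ : Fin r → contOneCocycles (discreteTopRep (absoluteGaloisGroup K) (geomTorsion (W.baseChange K) ((p : ℕ) : ℤ))) :=
    fun i ↦ reprCocycle (W.baseChange K) ((p : ℕ) : ℤ) (xs i) with hφdef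
  have hclass : ∀ i, oneCocycleClass _ (φ i) = xs i := fun i ↦ oneCocycleClass_reprCocycle (W.baseChange K) _ (xs i)
  set ξ : Fin r → absoluteGaloisGroup K → geomTorsion (W.baseChange K) ((p : ℕ) : ℤ) := fun i a ↦ (φ i).1 a with hξ
  have hcoc : ∀ (i) (a b : absoluteGaloisGroup K), ξ i (a * b) = ξ i a + a • ξ i b := fun i a b ↦ by
    have := (φ i).2 a b
    rw [discreteTopRep_ρ_apply] at this
    exact this
  have hξinv : ∀ (i) (a : absoluteGaloisGroup K), ξ i a⁻¹ = -(a⁻¹ • ξ i a) := fun i a ↦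
    cocycle_apply_inv (W.baseChange K) _ (φ i) a
  obtain ⟨κ₀, hκ₀⟩ : ∃ κ₀ : Fin r → geomTorsion (W.baseChange K) ((p : ℕ) : ℤ),
      ∀ i, ξ i (ht.conjGalCMH g₁ * g₁) = κ₀ i := ⟨_, fun _ ↦ rfl⟩
  -- the prescribed values: `e (y i) = (2⁻¹ (1 − (e (κ₀ i))₀), 0)`
  obtain ⟨y, hy⟩ : ∃ y : Fin r → geomTorsion (W.baseChange K) ((p : ℕ) : ℤ),
      ∀ i, y i = eT.symm ![(2 : ZMod p)⁻¹ * (1 - eT (κ₀ i) 0), 0] := ⟨_, fun _ ↦ rfl⟩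
  have hy0 : ∀ i, eT (y i) 0 = (2 : ZMod p)⁻¹ * (1 - eT (κ₀ i) 0) := fun i ↦ by rw [hy i, eT.apply_symm_apply]; rfl
  have hy1 : ∀ i, eT (y i) 1 = 0 := fun i ↦ by rw [hy i, eT.apply_symm_apply]; rfl
  obtain ⟨ρ, hρT, hρ⟩ := exists_h1Eval_eq (W.baseChange K) hp hS hCe hz hu xs hind y
  have hρy : ∀ i, ξ i ρ = y i := hρ
  -- ### Step C: the finite exceptional set of places of `ℚ`
  have hbad : ((W.baseChange K).badPlaces (𝓞 K)).Finite := (W.baseChange K).finite_badPlaces_holds (𝓞 K)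
  have hTex : ∀ i, ∃ T : Set (HeightOneSpectrum (𝓞 K)), T.Finite ∧ ∀ w ∉ T, ∀ 𝔓 ∈ w.primesAbove,
      xs i ∈ unramifiedKer (geomTorsion (W.baseChange K) ((p : ℕ) : ℤ)) 𝔓 := fun i ↦
    exists_finite_forall_mem_unramifiedKer (W.baseChange K) (n := ((p : ℕ) : ℤ)) hn0 (xs i)
  choose Tr hTrfin hTr using hTex
  set Tx : Set (HeightOneSpectrum (𝓞 K)) := ⋃ i, Tr i with hTxdef
  have hTxfin : Tx.Finite := Set.finite_iUnion hTrfin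
  have hTx : ∀ i, ∀ w ∉ Tx, ∀ 𝔓 ∈ w.primesAbove, xs i ∈ unramifiedKer (geomTorsion (W.baseChange K) ((p : ℕ) : ℤ)) 𝔓 :=
    fun i w hw 𝔓 h𝔓 ↦ hTr i w (fun h ↦ hw (Set.mem_iUnion.mpr ⟨i, h⟩)) 𝔓 h𝔓
  set B : Finset ℕ := {p} ∪ (W.conductorNorm ℤ).primeFactors ∪ (NumberField.discr K).natAbs.primeFactors ∪ B₀ with hB
  set S₁ : Set (HeightOneSpectrum (𝓞 ℚ)) := {v | ∃ q ∈ B, q.Prime ∧ (q : 𝓞 ℚ) ∈ v.asIdeal} with hS₁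
  set S₂ : Set (HeightOneSpectrum (𝓞 ℚ)) := {v | ¬ Algebra.IsUnramifiedIn (𝓞 K) v.asIdeal} with hS₂
  set S₃ : Set (HeightOneSpectrum (𝓞 ℚ)) :=
    (fun w : HeightOneSpectrum (𝓞 K) ↦ w.under (𝓞 ℚ)) '' ((W.baseChange K).badPlaces (𝓞 K) ∪ Tx) with hS₃
  have hS₁fin : S₁.Finite := by
    have : S₁ ⊆ ⋃ q ∈ (B.filter Nat.Prime), {v | (q : 𝓞 ℚ) ∈ v.asIdeal} := by
      intro v ⟨q, hqB, hq, hqv⟩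
      simp only [Set.mem_iUnion, Finset.mem_filter]
      exact ⟨q, ⟨hqB, hq⟩, hqv⟩
    refine Set.Finite.subset (Set.Finite.biUnion (Finset.finite_toSet _) fun q hq ↦ ?_) this
    rw [Finset.coe_filter, Set.mem_setOf_eq] at hq
    have hsub : {v : HeightOneSpectrum (𝓞 ℚ) | (q : 𝓞 ℚ) ∈ v.asIdeal}.Subsingleton :=
      fun v hv v' hv' ↦ HeightOneSpectrum.eq_of_natCast_mem_rat hq.2 hv hv'
    exact hsub.finite
  have hS₂fin : S₂.Finite := finite_setOf_not_isUnramifiedIn ℚ K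
  have hS₃fin : S₃.Finite := (hbad.union hTxfin).image _
  set S := S₁ ∪ S₂ ∪ S₃ with hSdef
  have hSfin : S.Finite := (hS₁fin.union hS₂fin).union hS₃fin
  -- ### Step D: Čebotarev in `Γ_ℚ`: a Frobenius in the open set `c₀ · res(g₁ ρ 𝒩)`
  set 𝒩 := evalKer (W.baseChange K) ((p : ℕ) : ℤ) xs with h𝒩
  have h𝒩open : IsOpen (𝒩 : Set (absoluteGaloisGroup K)) :=
    isOpen_evalKer (W.baseChange K) _ xs (isOpen_torsionFixing (W.baseChange K) hn0)
  set O : Set (absoluteGaloisGroup ℚ) :=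
    (fun γ ↦ c₀ * γ) '' (absGaloisRestrict ℚ K '' ((fun m ↦ (g₁ * ρ) * m) '' (𝒩 : Set _))) with hO
  have hOopen : IsOpen O := by
    refine (Homeomorph.mulLeft c₀).isOpenMap _ (isOpenMap_absGaloisRestrict K _ ?_)
    exact (Homeomorph.mulLeft (g₁ * ρ)).isOpenMap _ h𝒩open
  have hOne : O.Nonempty :=
    ⟨c₀ * absGaloisRestrict ℚ K ((g₁ * ρ) * 1), _, ⟨_, ⟨1, 𝒩.one_mem, rfl⟩, rfl⟩, rfl⟩
  obtain ⟨γ, hγO, v, hvS, 𝔓₀, h𝔓₀, hγ⟩ :=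
    (absoluteGaloisGroup.frobenius_dense Literature.NumberTheory.Automorphic.chebotarev_artinRep_holds ℚ S
      hSfin).inter_open_nonempty O hOopen hOne
  obtain ⟨_, ⟨_, ⟨m, hm, rfl⟩, rfl⟩, rfl⟩ := hγO
  set s := ρ * m with hs
  set g := g₁ * s with hg
  have hgeq : g₁ * ρ * m = g := by rw [hg, hs, mul_assoc]
  have hsT : s ∈ torsionFixing (W.baseChange K) ((p : ℕ) : ℤ) := mul_mem hρT hm.1
  dsimp only at hγ
  rw [hgeq] at hγ
  -- ### Step E: the rational prime `ℓ` under `v`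
  obtain ⟨ℓ, hℓ, hℓv⟩ := exists_prime_natCast_mem v
  have hℓB : ℓ ∉ B := fun h ↦ hvS (Or.inl (Or.inl ⟨ℓ, h, hℓ, hℓv⟩))
  simp only [hB, Finset.mem_union, Finset.mem_singleton, Nat.mem_primeFactors, not_or] at hℓB
  obtain ⟨⟨⟨hℓp, hℓN⟩, hℓD⟩, hℓB₀⟩ := hℓB
  have hℓN' : ¬ ℓ ∣ W.conductorNorm ℤ := fun h ↦ hℓN ⟨hℓ, h, (W.conductorNorm_pos_holds).ne'⟩
  have hℓD' : ¬ ((ℓ : ℤ) ∣ NumberField.discr K) := fun h ↦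
    hℓD ⟨hℓ, Int.natAbs_dvd_natAbs.mpr h |>.trans (by simp), by simp [NumberField.discr_ne_zero]⟩
  have hunr : Algebra.IsUnramifiedIn (𝓞 K) v.asIdeal := by
    by_contra h; exact hvS (Or.inl (Or.inr h))
  have hvS₃ : v ∉ S₃ := fun h ↦ hvS (Or.inr h)
  haveI : Fact ℓ.Prime := ⟨hℓ⟩
  have hℓp' : ℓ ≠ p := hℓp
  have hgoodℓ : W.HasGoodReductionAtPrime ℓ := by
    by_contra hbadℓ
    exact hℓN' ((W.dvd_conductorNorm_iff_not_hasGoodReductionAtPrime ℓ).mpr hbadℓ)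
  have hvℓ : (primesEquiv v : ℕ) = ℓ := primesEquiv_eq_of_natCast_mem hℓ hℓv
  -- ### Step F: `ℓ` is inert, with a Frobenius `τ' = conj(g) g` over `K`
  have hHi := index_range_absGaloisRestrict_eq_finrank ℚ K
  haveI hHn : ((absGaloisRestrict ℚ K).range).Normal :=
    Subgroup.normal_of_index_eq_two (hHi.trans hK.1)
  have hI := inertia_le_range_absGaloisRestrict_of_isUnramifiedIn (K := K) hunr h𝔓₀
  have hΦH : c₀ * absGaloisRestrict ℚ K g ∉ (absGaloisRestrict ℚ K).range := by
    intro h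
    apply hc₀.not_mem_range_absGaloisRestrict (L := K) IsTotallyComplex.isComplex
    change c₀ ∈ ((absGaloisRestrict ℚ K).range : Set (absoluteGaloisGroup ℚ))
    have h' : c₀ = c₀ * absGaloisRestrict ℚ K g * (absGaloisRestrict ℚ K g)⁻¹ := by group
    rw [SetLike.mem_coe, h']
    exact Subgroup.mul_mem _ h (Subgroup.inv_mem _ ⟨g, rfl⟩)
  obtain ⟨w, 𝔔, τ', hwv, hwuniq, -, h𝔔w, -, hτ', hresτ'⟩ :=
    exists_place_inert_of_not_mem_range (F := ℚ) (M := K) (hK.1 ▸ Nat.prime_two) hHn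
      (hHi.trans rfl) hunr h𝔓₀ hI hγ hΦH
  rw [hK.1, sq_eq_absGaloisRestrict_conjGal_mul hc₀ ht g] at hresτ'
  have hτ'eq : τ' = ht.conjGalCMH g * g := absGaloisRestrict_injective ℚ K hresτ'
  have hℓw : (ℓ : 𝓞 K) ∈ w.asIdeal := by
    have h1 : (ℓ : 𝓞 ℚ) ∈ (w.under (𝓞 ℚ)).asIdeal := by rw [hwv]; exact hℓv
    rw [HeightOneSpectrum.under_asIdeal, Ideal.under_def, Ideal.mem_comap, map_natCast] at h1
    exact h1
  have hwuniq' : ∀ w' : HeightOneSpectrum (𝓞 K), (ℓ : 𝓞 K) ∈ w'.asIdeal → w' = w := by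
    intro w' hw'
    apply hwuniq
    apply HeightOneSpectrum.eq_of_natCast_mem_rat hℓ _ hℓv
    rw [HeightOneSpectrum.under_asIdeal, Ideal.under_def, Ideal.mem_comap, map_natCast]
    exact hw'
  have hspan : Ideal.span {(ℓ : 𝓞 K)} = w.asIdeal := by
    apply span_natCast_eq_of_unique hℓ w hwuniq'
    haveI : w.asIdeal.LiesOver v.asIdeal := ⟨by rw [← hwv]; rfl⟩
    have hmap : v.asIdeal.map (algebraMap (𝓞 ℚ) (𝓞 K)) = Ideal.span {(ℓ : 𝓞 K)} := by
      rw [← span_natCast_rat_eq hℓ hℓv, Ideal.map_span, Set.image_singleton, map_natCast]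
    have hne : v.asIdeal.map (algebraMap (𝓞 ℚ) (𝓞 K)) ≠ ⊥ := by
      rw [hmap, Ne, Ideal.span_singleton_eq_bot]; exact_mod_cast hℓ.ne_zero
    rw [← hmap, ← Ideal.IsDedekindDomain.ramificationIdx_eq_normalizedFactors_count v.asIdeal
      w.asIdeal hne]
    exact Ideal.ramificationIdx_eq_one_iff.mpr (hunr w.asIdeal w.isPrime inferInstance)
  -- ### Step G: the values of the cocycles at `τ'`
  have hξm : ∀ i, ξ i m = 0 := fun i ↦ hm.2 i
  have hξs : ∀ i, ξ i s = y i := fun i ↦ by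
    rw [hs, hcoc, hρy, hξm, smul_zero, add_zero]
  have hBT : ht.conjGalCMH s ∈ torsionFixing (W.baseChange K) ((p : ℕ) : ℤ) :=
    ht.conjGalCMH_mem_torsionFixing W hinv _ hsT
  have hξcs : ∀ i, ξ i (ht.conjGalCMH s) = ν • T (y i) := fun i ↦ by
    have hcm : ht.conjGalCMH m ∈ 𝒩 :=
      ht.conjGalCMH_mem_evalKer W hinv _ (xs := xs) (ν := fun _ ↦ ν) (fun _ ↦ hν) hxν hm
    have hcs : ht.conjGalCMH s = ht.conjGalCMH ρ * ht.conjGalCMH m := by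
      change ht.conjGalHom (ρ * m) = ht.conjGalHom ρ * ht.conjGalHom m
      exact map_mul _ _ _
    have h1 : ξ i (ht.conjGalCMH ρ) = ν • T (ξ i ρ) := ht.h1Eval_conjGalCMH_of_eigen W hinv _ hν (hxν i) hρT
    have h2 : ξ i (ht.conjGalCMH m) = 0 := hcm.2 i
    rw [hcs, hcoc, smul_eq_of_mem_torsionFixing _ _ (ht.conjGalCMH_mem_torsionFixing W hinv _ hρT), h1, h2,
      add_zero, hρy]
  have hcg : ht.conjGalCMH g = ht.conjGalCMH g₁ * ht.conjGalCMH s := by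
    change ht.conjGalHom (g₁ * s) = ht.conjGalHom g₁ * ht.conjGalHom s
    exact map_mul _ _ _
  -- `e`-linearity for scalars `ν`
  have heν : ∀ (X : geomTorsion (W.baseChange K) ((p : ℕ) : ℤ)) (i : Fin 2), eT (ν • X) i = (ν : ZMod p) * eT X i :=
    fun X i ↦ by rw [map_zsmul, Pi.smul_apply, ← Int.cast_smul_eq_zsmul (ZMod p) ν (eT X i), smul_eq_mul]
  have hξτ' : ∀ i, ξ i τ' = κ₀ i + (ν • T (g₁ • y i) + T (g₁ • T (g₁ • y i))) := fun i ↦ by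
    -- `ξ(conj(g₁) conj(s) g₁ s) = κ₀ + conj(g₁) • (ν T y + g₁ y)`
    rw [hτ'eq, hcg, hg, hcoc, hcoc, hcoc, hξs, hξcs,
      mul_smul (ht.conjGalCMH g₁) (ht.conjGalCMH s) (ξ i g₁ + g₁ • y i), smul_eq_of_mem_torsionFixing _ _ hBT]
    have e1 : ξ i (ht.conjGalCMH g₁) + ht.conjGalCMH g₁ • ν • T (y i) + ht.conjGalCMH g₁ • (ξ i g₁ + g₁ • y i) =
        κ₀ i + ht.conjGalCMH g₁ • (ν • T (y i) + g₁ • y i) := by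
      rw [← hκ₀, hcoc, smul_add, smul_add]; abel
    rw [e1, hconj, map_add, map_zsmul, hTT, smul_add, smul_comm g₁ ν (y i), map_add, map_zsmul]
  have hξτ'0 : ∀ i, eT (ξ i τ') 0 = 1 := fun i ↦ by
    rw [hξτ', map_add, map_add, Pi.add_apply, Pi.add_apply, heν, (hD1 (y i)).1, (hD2 (y i)).1, hy0, ← mul_assoc, hννk,
      one_mul]
    have : (2 : ZMod p)⁻¹ * 2 = 1 := inv_mul_cancel₀ htwo
    linear_combination (1 - eT (κ₀ i) 0) * this
  -- the action of `τ'` on `E(K̄)[p]`: `τ' M = T g₁ T g₁ M`, first coordinate unchanged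
  have hτ'M : ∀ M : geomTorsion (W.baseChange K) ((p : ℕ) : ℤ), τ' • M = T (g₁ • T (g₁ • M)) := fun M ↦ by
    rw [hτ'eq, hcg, hg]
    simp only [mul_smul, smul_eq_of_mem_torsionFixing _ _ hsT, smul_eq_of_mem_torsionFixing _ _ hBT]
    rw [hconj]
  have hnot : ∀ i, ¬ ∃ M : geomTorsion (W.baseChange K) ((p : ℕ) : ℤ), ξ i τ' = τ' • M - M := by
    rintro i ⟨M, hM⟩
    have h : eT (ξ i τ') 0 = eT (τ' • M - M) 0 := by rw [hM]
    rw [hξτ'0, map_sub, Pi.sub_apply, hτ'M, (hD2 M).1, sub_self] at h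
    exact one_ne_zero h
  -- `γ = c₀ · res g` acts on `E(ℚ̄)[p]` as `D` (through `eT ∘ θ`)
  have hact : ∀ P : geomTorsion W ((p : ℕ) : ℤ),
      (θ.trans eT) ((c₀ * absGaloisRestrict ℚ K g) • P) =
        ![(ν : ZMod p) * (θ.trans eT) P 0, (ν : ZMod p) * 2 * (θ.trans eT) P 1] := fun P ↦ by
    have hresg : absGaloisRestrict ℚ K g = absGaloisRestrict ℚ K g₁ * absGaloisRestrict ℚ K s := by
      change absGaloisRestrict ℚ K (g₁ * s) = _
      exact map_mul _ _ _
    rw [AddEquiv.trans_apply, AddEquiv.trans_apply, hresg, ← mul_assoc,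
      mul_smul (c₀ * absGaloisRestrict ℚ K g₁) (absGaloisRestrict ℚ K s) P,
      absGaloisRestrict_smul_eq_of_mem_torsionFixing W hsT]
    exact hγ₁ P
  have hmod := isAdmissible_congruences_of_frob W h5 hℓp' hgoodℓ hvℓ h𝔓₀ hγ (θ.trans eT) hν hact
  -- ### Step H: assemble
  have hℓpN : ¬ ℓ ∣ p * W.conductorNorm ℤ := by
    intro h
    rcases (Nat.Prime.dvd_mul hℓ).mp h with h' | h'
    · exact hℓp' ((Nat.prime_dvd_prime_iff_eq hℓ hp).mp h')
    · exact hℓN' h'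
  refine ⟨ℓ, hℓB₀, ⟨hℓ, hℓpN, hspan ▸ w.isPrime, hmod.1, hmod.2⟩, w, hℓw, fun i hxker ↦ ?_⟩
  -- ### the local criterion at `w` (Gross Prop. 9.6 at the non-trivial Frobenius `δ τ' δ⁻¹`)
  haveI : CharZero (w.adicCompletion K) :=
    charZero_of_injective_algebraMap (algebraMap K (w.adicCompletion K)).injective
  obtain ⟨𝔐, h𝔐⟩ := w.localPrimesAbove_nonempty
  set 𝔓w := w.primeBelow (closureEmb (K := K) (w.adicCompletion K)) 𝔐 with h𝔓w_def
  have h𝔓w : 𝔓w ∈ w.primesAbove := w.primeBelow_mem_primesAbove h𝔐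
  haveI : 𝔓w.IsPrime := h𝔓w.1
  obtain ⟨δ, -, hF⟩ := HeightOneSpectrum.exists_isArithFrobAt_conj_of_mem_primesAbove_holds h𝔔w h𝔓w hτ'
  have hwbad : w ∉ (W.baseChange K).badPlaces (𝓞 K) := fun h ↦ hvS₃ ⟨w, Or.inl h, hwv⟩
  have hwT : w ∉ Tx := fun h ↦ hvS₃ ⟨w, Or.inr h, hwv⟩
  have hpw : ((((p : ℕ) : ℤ)) : 𝓞 K) ∉ w.asIdeal := by
    rw [Int.cast_natCast]
    exact not_natCast_mem_of_prime_ne hℓ hp hℓp' w hℓw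
  have hIw : 𝔓w.inertia (absoluteGaloisGroup K) ≤ torsionFixing (W.baseChange K) ((p : ℕ) : ℤ) :=
    inertia_le_torsionFixing (W.baseChange K) hwbad hpw _ h𝔐
  have hφI : ∀ j ∈ 𝔓w.inertia (absoluteGaloisGroup K), (φ i).1 j = 0 := by
    have hx' : oneCocycleClass _ (φ i) ∈ unramifiedKer (geomTorsion (W.baseChange K) ((p : ℕ) : ℤ)) 𝔓w := by
      rw [hclass]; exact hTx i w hwT 𝔓w h𝔓w
    obtain ⟨a, ha⟩ := (oneCocycleClass_mem_subgroupResKer_iff _ (φ i)).mp hx'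
    intro j hj
    rw [ha ⟨j, hj⟩, Subgroup.coe_mk, smul_eq_of_mem_torsionFixing (W.baseChange K) _ (hIw hj), sub_self]
  have hcrit := LocalFrob.oneCocycleClass_mem_torsionLocalKer_iff_apply_frob (W.baseChange K) (n := p)
    hp.ne_zero h𝔐 hF hIw (φ i) hφI
  rw [hclass] at hcrit
  obtain ⟨m', hm'⟩ := hcrit.mp hxker
  have hm'' : ξ i (δ * τ' * δ⁻¹) = (δ * τ' * δ⁻¹) • m' - m' := hm'
  -- from `ξ(δ τ' δ⁻¹) = ∂m'` to `ξ(τ') = ∂M` with `M = δ⁻¹ (m' + ξ δ)`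
  apply hnot i
  refine ⟨δ⁻¹ • (m' + ξ i δ), (smul_left_cancel_iff δ).mp ?_⟩
  have h1 : ξ i (δ * τ' * δ⁻¹) = ξ i δ + δ • ξ i τ' - (δ * τ' * δ⁻¹) • ξ i δ := by
    rw [hcoc, hcoc, hξinv i δ, smul_neg, mul_smul (δ * τ') δ⁻¹ (ξ i δ)]
    abel
  rw [h1] at hm''
  have hR : δ • (τ' • (δ⁻¹ • (m' + ξ i δ)) - δ⁻¹ • (m' + ξ i δ)) =
      (δ * τ' * δ⁻¹) • (m' + ξ i δ) - (m' + ξ i δ) := by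
    rw [smul_sub, smul_inv_smul, mul_smul (δ * τ') δ⁻¹ (m' + ξ i δ), mul_smul δ τ' (δ⁻¹ • (m' + ξ i δ))]
  have e : δ • ξ i τ' = (ξ i δ + δ • ξ i τ' - (δ * τ' * δ⁻¹) • ξ i δ) - ξ i δ + (δ * τ' * δ⁻¹) • ξ i δ := by
    abel
  rw [hR, e, hm'', smul_add]
  abel

end Main

end Summit.BirchSwinnertonDyer.BirchSwinnertonDyer.Theorems.SignedBaseChangeAcDivAdmdefChebSplitFamily

end
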